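import Summits.ValiantsHypothesis.ValiantsHypothesis.Theorems.BarrierLeverChowBenchmarkPairsSplitCertNode
import Summits.ValiantsHypothesis.ValiantsHypothesis.Theorems.BarrierLeverChowBenchmarkPairsSplitCertInstancesA

/-!
# Route BarrierLever — item 22038 `ChowBenchmarkPairs`, line `moore-peel`: SPLIT CERTIFICATES — the CANONICAL enumeration:
# `HSMVAt h ⟹ SegmentMeanValueAt h`, the canonical node text, and `SegmentMeanValueAt h` for every `h ≤ 10` BY CERTIFICATE

Helper file (`--supports stmt-ValiantsHypothesis-22038`; cell valiant-natproofs, rung V4; seat val-np-p4 gen 24).  Closes NO item.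

`…SplitCertHomog` states homogeneous unisolvence `HSMVAt h` on the row LIST `hRows h` (the form the kernel instances `…SplitCertInstancesA`
certify); `…SplitCertNode` proves the bridge «homogeneous ⇒ segment mean value» for an arbitrary enumeration `u` through its encoding `hEncL u`.
This file joins the two: the CANONICAL enumeration `canonU h : Fin r_h → Finset (Fin h)` read off `hRows h` (`[0] ↦ ∅`, `[0,a+1] ↦ {a}`,
`[a+1,b+1] ↦ {a,b}`) has homogeneous rows = the supports of `hRows h` with the same weights (`dirE_canonU`), covers every subset of size
≤ 2 (`canonU_covers`, via `length_hRows : |hRows h| = windowStart (h+1)`), so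

* **`smv_of_hsmv : HSMVAt h → SegmentMeanValueAt h`** (verbatim; `smv_canon_of_hsmv` + the row-permutation transfer `smv_transfer`
  between covering enumerations);
* **NODE (canonical text) `Stmt.splitCertCanon := ∀ h, ∃ levels, Cert.check h r_h levels (rootInstW (hRows h) hWts r_h) = true`** with
  ARROW `segmentMeanValue_of_splitCertCanon : Stmt.splitCertCanon → ∀ h, SegmentMeanValueAt h` — the simplest registrable text for slot #7
  (equivalent in content to `…SplitCertNode.Stmt.splitCertH`);
* **`segmentMeanValueAt_of_le_ten`**: `SegmentMeanValueAt h` for every `h ≤ 10` from the kernel-checked certificates `hsmvAt_of_le_ten` —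
  the certificate pipeline validated end-to-end in the stub's own language (inside the certified window `h ≤ 182`; method validation).

WHAT THIS IS NOT: the node is a typed CONJECTURE (kernel instances `h ≤ 10`, replica-checked `h ≤ 12`, g23's trees `h ≤ 31`); no stub of
the line is closed; nothing on crux stmt-ValiantsHypothesis-14610 or on `VP` versus `VNP`.
-/

set_option linter.dupNamespace false
set_option autoImplicit false

namespace Summit.ValiantsHypothesis.ValiantsHypothesis.Theorems.BarrierLever.ChowBenchmarkSplit

open Finset
open Literature.Computability.Complexity (getD_ofFn)
open Summit.ValiantsHypothesis.ValiantsHypothesis.Theorems.BarrierLever.MoorePeel (benchCols windowStart windowStart_succ_le_two_pow)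
open Summit.ValiantsHypothesis.ValiantsHypothesis.Theorems.BarrierLever.ChowBenchmarkPeel (segE)
open Summit.ValiantsHypothesis.ValiantsHypothesis.Theorems.BarrierLever.ChowBenchmarkDual (eq_windowStart_of_enumeration)

section Canonical

variable {h : ℕ}

/-- The rows after the origin row. -/
def hTail (h : ℕ) : List (List ℕ) :=
  (List.range h).map (fun a => [0, a + 1]) ++ (List.range h).flatMap fun b => (List.range b).map fun a => [a + 1, b + 1]

/-- `hRows h = [0] :: hTail h`. -/
theorem hRows_eq_cons (h : ℕ) : Cert.hRows h = [0] :: hTail h := rfl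

/-- The shape of a tail row: `[0, a+1]` (`a < h`) or `[a+1, b+1]` (`a < b < h`). -/
theorem hTail_mem_shape {r : List ℕ} (hr : r ∈ hTail h) :
    (∃ a, a < h ∧ r = [0, a + 1]) ∨ (∃ a b, a < b ∧ b < h ∧ r = [a + 1, b + 1]) := by
  unfold hTail at hr
  simp only [List.mem_append, List.mem_map, List.mem_range, List.mem_flatMap] at hr
  rcases hr with ⟨a, ha, rfl⟩ | ⟨b, hb, a, ha, rfl⟩
  · exact Or.inl ⟨a, ha, rfl⟩
  · exact Or.inr ⟨a, b, ha, hb, rfl⟩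

/-- Twice the number of pair rows is `h (h-1)`. -/
theorem two_mul_pairs (h : ℕ) : 2 * ((List.range h).flatMap fun b => (List.range b).map fun a => [a + 1, b + 1]).length = h * (h - 1) := by
  induction h with
  | zero => simp
  | succ m ih =>
    rw [List.range_succ, List.flatMap_append, List.length_append, mul_add, ih]
    simp only [List.flatMap_cons, List.flatMap_nil, List.append_nil, List.length_map, List.length_range, Nat.add_sub_cancel]
    rcases m with _ | m
    · simp
    · rw [Nat.add_sub_cancel]; ring

/-- **The number of homogeneous rows is `r_h = windowStart (h+1)`.** -/
theorem length_hRows (h : ℕ) : (Cert.hRows h).length = windowStart (h + 1) := by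
  rw [hRows_eq_cons, List.length_cons, hTail, List.length_append, List.length_map, List.length_range, windowStart,
    Nat.add_sub_cancel]
  have e := two_mul_pairs h
  set L := ((List.range h).flatMap fun b => (List.range b).map fun a => [a + 1, b + 1]).length
  have e2 : (h + 1) * h = 2 * (h + L) := by
    rcases h with _ | m
    · simp at e ⊢; omega
    · rw [Nat.add_sub_cancel] at e
      nlinarith [e]
  rw [e2, Nat.mul_div_cancel_left _ (by norm_num : 0 < 2)]
  ring

/-- **The canonical enumeration** of the subsets of `Fin h` of size ≤ 2, read off the homogeneous rows (the shift `a ↦ a+1` undone). -/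
def canonU (h : ℕ) (i : Fin (windowStart (h + 1))) : Finset (Fin h) :=
  Finset.univ.filter fun a : Fin h => (a : ℕ) + 1 ∈ (Cert.hRows h).getD i []

/-- Row `i`: either `i = 0` and the row is `[0]`, or `i > 0` and the row is a tail shape. -/
theorem hRows_getD_cases (i : Fin (windowStart (h + 1))) :
    ((i : ℕ) = 0 ∧ (Cert.hRows h).getD i [] = [0]) ∨
      ((i : ℕ) ≠ 0 ∧ ((∃ a, a < h ∧ (Cert.hRows h).getD i [] = [0, a + 1]) ∨
        (∃ a b, a < b ∧ b < h ∧ (Cert.hRows h).getD i [] = [a + 1, b + 1]))) := by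
  have hi : (i : ℕ) < (Cert.hRows h).length := by rw [length_hRows]; exact i.2
  rcases Nat.eq_zero_or_pos (i : ℕ) with h0 | hpos
  · exact Or.inl ⟨h0, by rw [h0]; rfl⟩
  · refine Or.inr ⟨Nat.pos_iff_ne_zero.mp hpos, ?_⟩
    obtain ⟨j, hj⟩ : ∃ j, (i : ℕ) = j + 1 := ⟨(i : ℕ) - 1, by omega⟩
    rw [hj, hRows_eq_cons, List.getD_cons_succ]
    have hj' : j < (hTail h).length := by
      rw [hRows_eq_cons, List.length_cons, hj] at hi; omega
    rw [List.getD_eq_getElem _ _ hj']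
    exact hTail_mem_shape (List.getElem_mem hj')

/-- **Row `i` and the canonical set `i` determine the same homogeneous row, with the same weights on it.** -/
theorem dirE_canonU {R : Type*} [CommRing R] (P : Fin (h + 1) → Fin h → R) (i : Fin (windowStart (h + 1))) (T : Finset (Fin h)) :
    dirE P (Cert.Sof (h + 1) ((Cert.hRows h).getD i [])) (Cert.hwOf h i) T = dirE P (hS (canonU h i)) (hw (canonU h i)) T := by
  rcases hRows_getD_cases i with ⟨hi0, e⟩ | ⟨hi0, ⟨a, ha, e⟩ | ⟨a, b, hab, hb, e⟩⟩
  · -- origin row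
    have hc : canonU h i = ∅ := by unfold canonU; rw [e]; ext x; simp
    rw [e, hc, Cert.Sof_single (Nat.succ_pos h), hS, if_pos (by simp), Finset.map_empty]
    have eS : (insert (0 : Fin (h + 1)) (∅ : Finset (Fin (h + 1)))) = {⟨0, Nat.succ_pos h⟩} := rfl
    rw [eS]
    refine Cert.dirE_congr_weights P _ _ fun x hx => ?_
    rw [Finset.mem_singleton] at hx
    subst hx
    unfold Cert.hwOf hw Cert.hWts
    rw [e, hi0]
    simp [Cert.wOf]
  · -- one point `a`
    have hc : canonU h i = {⟨a, ha⟩} := by unfold canonU; rw [e]; ext x; simp [Fin.ext_iff]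
    rw [e, hc, Cert.Sof_pair (Nat.succ_pos h) (Nat.succ_lt_succ ha), hS, if_pos (by simp), Finset.map_singleton]
    have eS : ({⟨0, Nat.succ_pos h⟩, ⟨a + 1, Nat.succ_lt_succ ha⟩} : Finset (Fin (h + 1))) =
        insert 0 {(Fin.succEmb h) ⟨a, ha⟩} := rfl
    rw [eS]
    refine Cert.dirE_congr_weights P _ _ fun x hx => ?_
    unfold Cert.hwOf hw
    rw [show Cert.hWts.getD (i : ℕ) (1, 1) = (1, 1) from List.getD_eq_default _ _ (by simp [Cert.hWts]; omega), e,
      Finset.card_singleton]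
    simp only [Finset.mem_insert, Finset.mem_singleton] at hx
    rcases hx with rfl | rfl <;> simp [Cert.wOf]
  · -- two points `a < b`
    have ha : a < h := lt_trans hab hb
    have hc : canonU h i = {⟨a, ha⟩, ⟨b, hb⟩} := by unfold canonU; rw [e]; ext x; simp [Fin.ext_iff]
    have hne : (⟨a, ha⟩ : Fin h) ≠ ⟨b, hb⟩ := fun hx => absurd (Fin.mk.inj_iff.mp hx) (Nat.ne_of_lt hab)
    rw [e, hc, Cert.Sof_pair (Nat.succ_lt_succ ha) (Nat.succ_lt_succ hb), hS, if_neg (by rw [Finset.card_pair hne]; omega)]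
    have eS : ({⟨a + 1, Nat.succ_lt_succ ha⟩, ⟨b + 1, Nat.succ_lt_succ hb⟩} : Finset (Fin (h + 1))) =
        ({⟨a, ha⟩, ⟨b, hb⟩} : Finset (Fin h)).map (Fin.succEmb h) := by
      rw [Finset.map_insert, Finset.map_singleton]; rfl
    rw [eS]
    refine Cert.dirE_congr_weights P _ _ fun x hx => ?_
    unfold Cert.hwOf hw
    rw [show Cert.hWts.getD (i : ℕ) (1, 1) = (1, 1) from List.getD_eq_default _ _ (by simp [Cert.hWts]; omega), e,
      Finset.card_pair hne]
    simp only [Finset.mem_map, Finset.mem_insert, Finset.mem_singleton] at hx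
    obtain ⟨y, hy, rfl⟩ := hx
    rcases hy with rfl | rfl <;> simp [Cert.wOf]

/-- **The canonical enumeration covers every subset of size ≤ 2.** -/
theorem canonU_covers (S : Finset (Fin h)) (hS2 : S.card ≤ 2) : ∃ i, canonU h i = S := by
  -- the list shape of `S` and its membership in `hRows`
  have key : ∃ L ∈ Cert.hRows h, (Finset.univ.filter fun a : Fin h => (a : ℕ) + 1 ∈ L) = S := by
    rcases Nat.lt_or_ge S.card 1 with h0 | h1
    · refine ⟨[0], by rw [hRows_eq_cons]; exact List.mem_cons_self, ?_⟩
      have hS0 : S = ∅ := Finset.card_eq_zero.mp (by omega)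
      subst hS0; ext x; simp
    · by_cases hle : S.card ≤ 1
      · obtain ⟨a, rfl⟩ := Finset.card_eq_one.mp (show S.card = 1 by omega)
        refine ⟨[0, (a : ℕ) + 1], ?_, by ext x; simp [Fin.ext_iff]⟩
        rw [hRows_eq_cons]; apply List.mem_cons_of_mem
        unfold hTail; simp only [List.mem_append, List.mem_map, List.mem_range, List.mem_flatMap]
        exact Or.inl ⟨a, a.2, rfl⟩
      · obtain ⟨a, b, hab, rfl⟩ := Finset.card_eq_two.mp (show S.card = 2 by omega)
        -- order the two points
        rcases lt_or_gt_of_ne hab with hlt | hgt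
        · refine ⟨[(a : ℕ) + 1, (b : ℕ) + 1], ?_, by ext x; simp [Fin.ext_iff]⟩
          rw [hRows_eq_cons]; apply List.mem_cons_of_mem
          unfold hTail; simp only [List.mem_append, List.mem_map, List.mem_range, List.mem_flatMap]
          exact Or.inr ⟨b, b.2, a, hlt, rfl⟩
        · refine ⟨[(b : ℕ) + 1, (a : ℕ) + 1], ?_, by ext x; simp [Fin.ext_iff]; tauto⟩
          rw [hRows_eq_cons]; apply List.mem_cons_of_mem
          unfold hTail; simp only [List.mem_append, List.mem_map, List.mem_range, List.mem_flatMap]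
          exact Or.inr ⟨a, a.2, b, hgt, rfl⟩
  obtain ⟨L, hL, hLS⟩ := key
  obtain ⟨j, hj, rfl⟩ := List.getElem_of_mem hL
  refine ⟨⟨j, by rw [← length_hRows]; exact hj⟩, ?_⟩
  unfold canonU
  rw [show (Cert.hRows h).getD (⟨j, _⟩ : Fin (windowStart (h + 1))) [] = (Cert.hRows h)[j] from List.getD_eq_getElem _ _ hj]
  exact hLS

/-- The canonical sets have size ≤ 2. -/
theorem card_canonU (i : Fin (windowStart (h + 1))) : (canonU h i).card ≤ 2 := by
  rcases hRows_getD_cases i with ⟨_, e⟩ | ⟨_, ⟨a, ha, e⟩ | ⟨a, b, hab, hb, e⟩⟩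
  · have hc : canonU h i = ∅ := by unfold canonU; rw [e]; ext x; simp
    rw [hc]; simp
  · have hc : canonU h i = {⟨a, ha⟩} := by unfold canonU; rw [e]; ext x; simp [Fin.ext_iff]
    rw [hc]; simp
  · have hc : canonU h i = {⟨a, lt_trans hab hb⟩, ⟨b, hb⟩} := by unfold canonU; rw [e]; ext x; simp [Fin.ext_iff]
    rw [hc]; exact Finset.card_le_two

/-- **`HSMVAt h` gives `SegmentMeanValueAt` nonsingularity for the CANONICAL enumeration.** -/
theorem smv_canon_of_hsmv (H : Cert.HSMVAt h) :
    ∃ Q : Fin h → Fin h → ℂ, (Matrix.of fun i j : Fin (windowStart (h + 1)) => segE Q (canonU h i) (benchCols h _ j)).det ≠ 0 := by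
  obtain ⟨P, hP⟩ := H
  have e : (Matrix.of fun i j : Fin (windowStart (h + 1)) =>
      dirE P (Cert.Sof (h + 1) ((Cert.hRows h).getD i [])) (Cert.hwOf h i) (Cert.Tof h j)) = homMatrix (canonU h) P := by
    refine Matrix.ext fun i j => ?_
    rw [Matrix.of_apply, homMatrix, Matrix.of_apply, dirE_canonU]
    rfl
  rw [e] at hP
  exact smv_of_hom (windowStart_succ_le_two_pow h) (canonU h) card_canonU P hP

/-- **TRANSFER between enumerations**: nonsingularity for one COVERING enumeration gives it for every injective covering one (a row
permutation). -/
theorem smv_transfer {r₀ r : ℕ} (u₀ : Fin r₀ → Finset (Fin h)) (hcov : ∀ S : Finset (Fin h), S.card ≤ 2 → ∃ i, u₀ i = S)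
    (hr₀ : r₀ = windowStart (h + 1)) (Q : Fin h → Fin h → ℂ)
    (hQ : (Matrix.of fun i j : Fin r₀ => segE Q (u₀ i) (benchCols h r₀ j)).det ≠ 0)
    (u : Fin r → Finset (Fin h)) (hu : Function.Injective u) (hu2 : ∀ i, (u i).card ≤ 2)
    (hsurj : ∀ S : Finset (Fin h), S.card ≤ 2 → ∃ i, u i = S) :
    (Matrix.of fun i j : Fin r => segE Q (u i) (benchCols h r j)).det ≠ 0 := by
  classical
  have hr : r = r₀ := (eq_windowStart_of_enumeration u hu hu2 hsurj).trans hr₀.symm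
  subst hr
  -- the row permutation
  have hσ : ∀ i : Fin r, ∃ i', u₀ i' = u i := fun i => hcov (u i) (hu2 i)
  choose σ hσ using hσ
  have hinj : Function.Injective σ := fun i j e => hu (by rw [← hσ i, ← hσ j, e])
  let eσ : Equiv.Perm (Fin r) := Equiv.ofBijective σ (Finite.injective_iff_bijective.mp hinj)
  have hM : (Matrix.of fun i j : Fin r => segE Q (u i) (benchCols h r j)) =
      (Matrix.of fun i j : Fin r => segE Q (u₀ i) (benchCols h r j)).submatrix eσ id := by
    refine Matrix.ext fun i j => ?_
    rw [Matrix.submatrix_apply, Matrix.of_apply, Matrix.of_apply, id]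
    show segE Q (u i) _ = segE Q (u₀ (σ i)) _
    rw [hσ i]
  rw [hM, Matrix.det_permute]
  exact mul_ne_zero (by exact_mod_cast (Equiv.Perm.sign eσ).ne_zero) hQ

/-- **`HSMVAt h ⟹ SegmentMeanValueAt h`** (the line's statement at height `h`, verbatim). -/
theorem smv_of_hsmv (H : Cert.HSMVAt h) :
    ∀ (r : ℕ) (u : Fin r → Finset (Fin h)), Function.Injective u → (∀ i, (u i).card ≤ 2) →
      (∀ S : Finset (Fin h), S.card ≤ 2 → ∃ i, u i = S) →
      ∃ P : Fin h → Fin h → ℂ,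
        (Matrix.of fun i j : Fin r =>
          ∑ g : (↥(benchCols h r j) → ↥(u i)), (∏ c : ↥(benchCols h r j), P (g c) c) *
            ∏ a : ↥(u i),
              ((Finset.univ.filter fun c : ↥(benchCols h r j) => g c = a).card.factorial : ℂ)).det ≠ 0 := by
  intro r u hu hu2 hsurj
  obtain ⟨Q, hQ⟩ := smv_canon_of_hsmv H
  exact ⟨Q, smv_transfer (canonU h) canonU_covers rfl Q hQ u hu hu2 hsurj⟩

/-- **TYPED NODE, canonical form — «every height has a split certificate for the canonical homogeneous root».**  Simplest text for the
registry: `∀ h, ∃ levels, Cert.check h r_h levels (rootInstW (hRows h) hWts r_h) = true`; kernel instances `h ≤ 10` in `…SplitCertInstancesA`. -/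
def Stmt.splitCertCanon : Prop :=
  ∀ h : ℕ, ∃ ls : List Cert.Level,
    Cert.check h (windowStart (h + 1)) ls (Cert.rootInstW (Cert.hRows h) Cert.hWts (windowStart (h + 1))) = true

/-- **ARROW: the canonical node implies `∀ h, SegmentMeanValueAt h`** (the registered stub, verbatim). -/
theorem segmentMeanValue_of_splitCertCanon (H : Stmt.splitCertCanon) : ∀ h : ℕ,
    ∀ (r : ℕ) (u : Fin r → Finset (Fin h)), Function.Injective u → (∀ i, (u i).card ≤ 2) →
      (∀ S : Finset (Fin h), S.card ≤ 2 → ∃ i, u i = S) →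
      ∃ P : Fin h → Fin h → ℂ,
        (Matrix.of fun i j : Fin r =>
          ∑ g : (↥(benchCols h r j) → ↥(u i)), (∏ c : ↥(benchCols h r j), P (g c) c) *
            ∏ a : ↥(u i),
              ((Finset.univ.filter fun c : ↥(benchCols h r j) => g c = a).card.factorial : ℂ)).det ≠ 0 := by
  intro h
  obtain ⟨ls, hls⟩ := H h
  exact smv_of_hsmv (Cert.hsmv_of_check h ls hls)

/-- **`SegmentMeanValueAt h` for every `h ≤ 10`, by the kernel-checked split certificates** (inside the certified window `h ≤ 182` of
`…ChowBenchmarkPairsWindow` — an end-to-end validation of the certificate pipeline in the stub's own language). -/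
theorem segmentMeanValueAt_of_le_ten (h : ℕ) (hh : h ≤ 10) :
    ∀ (r : ℕ) (u : Fin r → Finset (Fin h)), Function.Injective u → (∀ i, (u i).card ≤ 2) →
      (∀ S : Finset (Fin h), S.card ≤ 2 → ∃ i, u i = S) →
      ∃ P : Fin h → Fin h → ℂ,
        (Matrix.of fun i j : Fin r =>
          ∑ g : (↥(benchCols h r j) → ↥(u i)), (∏ c : ↥(benchCols h r j), P (g c) c) *
            ∏ a : ↥(u i),
              ((Finset.univ.filter fun c : ↥(benchCols h r j) => g c = a).card.factorial : ℂ)).det ≠ 0 :=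
  smv_of_hsmv (Cert.hsmvAt_of_le_ten h hh)

end Canonical

end Summit.ValiantsHypothesis.ValiantsHypothesis.Theorems.BarrierLever.ChowBenchmarkSplit
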